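import Mathlib
import Literature.NumberTheory.LFunctions.Zhang2022.Section16I3plusShift
import Literature.NumberTheory.LFunctions.Zhang2022.Section15I2plusTheta2
import Literature.NumberTheory.LFunctions.Zhang2022.Section4Prop22Eventually
import HarnessLib

/-!
# Zhang (2022) §15 p. 81, (15.5): moving `I₂⁺(ψ)` from `𝔍(α)` to `𝔍(1)` —
# `Σ_{ψ∈Ψ₁} I₂⁺(ψ) = Θ₂(0,𝐤₁*,𝐚₁*) + O(ε)` (χ-absorbed reading), kernel-checked

Topic `Literature/NumberTheory/LFunctions/Zhang2022` (Landau–Siegel audit tree; verdict-neutral).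
Y. Zhang, *Discrete mean estimates and the Landau–Siegel zero*, arXiv:2211.02515v1 (2022)
[Zhang2022LandauSiegel] — **an unrefereed manuscript under adjudication; nothing in this file asserts or
denies its Theorems 1–2.** ZHANG-L discharge lane, node `Z22:(15.5)` = `Typed.Section15A.Eq15_5 c′ bChi`
under the leaf `Typed.Section15A.Eq15_6 c′ bChi` (§15 p. 81, tex L4081):

> Hence, moving the segment `𝔍(α)` to `𝔍(1)` with a negligible error, we obtain
> `Σ_{ψ∈Ψ₁} I₂⁺(ψ) = Θ₂(0,𝐤₁*,𝐚₁*) + O(ε)` with `κ₁*(m) = (κ₁∗b)(m)`, `a₁*(n) = g̃₃(n)`.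

The Dirichlet-series identity on `𝔍(1)` is `Typed.Section15A.sum_I2pm_one_eq_Theta2` and the reduction
of (15.5) to the per-character segment move is `Typed.Section15A.eq15_5_chi_of_shift` (both in
`Section15I2plusTheta2`). This file does the move — the §15 twin of the tree's §16 file
`Section16I3plusShift` (`Step16u010.sum_I3plus_sub_Theta2_le_of`, itself the twin of `Z22:§8.u016`), whose
sizes and mechanism are reused, with `I₂⁺(ψ) = (1/2πi)∫_{𝔍(α)} 𝔨₁(s,ψ)ω(s)ds`,
`𝔨₁ = Z(s,χψ)⁻¹(L(s+β₁,ψ)L(s+β₂,ψ)/L(s,ψ))B(s,ψ)K(1−s−β₃,ψ̄)` (`Typed.Section15A.frakk1`, `I2pm`):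

* `differentiableOn_frakk1_omega` — for `ψ ∈ Ψ₁` the integrand `𝔨₁(s,ψ)ω(s)` is HOLOMORPHIC on the
  closed rectangle `[½+α, 3/2] × [2πt₀−𝓛₁, 2πt₀+𝓛₁]`: `L(s,ψ) ≠ 0` there because "by Proposition 2.2"
  the zeros of `L(s,ψ)L(s,ψχ)` in `Ω` lie on `σ = ½` (`Step8u016.LFunction_ne_zero_of_onLine`);
* `norm_frakk1_omega_le`, `norm_frakk1_omega_le_uniform` — on the horizontal sides the integrand is
  `≤ K·P¹³·exp(3C𝓛⁹(1+9log𝓛))·e^{−𝓛¹⁰/4}` (`|Z(s,χψ)⁻¹| ≤ e³Dpt₀`, `Step16u010.norm_Zpc_inv_le`;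
  `|L(s+β_j,ψ)| ≤ p(|t|+5)Z`, `j = 1,2`; `|L(s,ψ)|⁻¹ ≤ exp(C(1+log(1/α))ℒ)` by the tree's
  `DirichletDisc.exp_neg_le_norm_LFunction`; `|B| ≤ K_B(P+1)²`, `|K| ≤ (2P₄+1)²`; the Gaussian
  `|ω| ≤ 6e^{−𝓛¹⁰/4}`);
* `norm_I2pm_shift_le_of` — per character: from `Skeleton.Prop22i`, for all large `D` and every
  `ψ ∈ Ψ₁`, `‖I₂(ψ;𝔍(α)) − I₂(ψ;𝔍(1))‖ ≤ e^{−𝓛¹⁰/16}` (Cauchy's theorem via the tree's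
  `Section7aStatements.norm_intJ_sub_intJ_le`; `Step8u016.growth_le`);
* `eq15_5_chi_of_prop22i`, **`eq15_5_chi_holds : Eq15_5 c′ bChi` for every real `c′`** — node
  `Z22:(15.5)` (χ-absorbed reading of record) DISCHARGED outright, Proposition 2.2 (i) being the tree
  theorem `Skeleton.prop22i_holds`.

Theorems only; no definitions, no named facts; axioms standard. WHAT THIS IS NOT: a proof of (15.6)
(which also needs (15.3), (15.4) and Proposition 14.1), nor any claim about Theorems 1–2 of the source
or about Landau–Siegel zeros.

## References

* Y. Zhang, arXiv:2211.02515v1 (2022), §15 pp. 79–81 (u001, u003, (15.5)); §8 p. 43 (the template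
  move); §2 (2.7)–(2.15). [cite: Zhang2022LandauSiegel, §15 (15.5) p. 81]
* H. L. Montgomery, R. C. Vaughan, *Multiplicative Number Theory I* (2007), Lemma 12.6 (the lower bound
  for `|L(s,χ)|` off the zeros, tree file `DirichletLFunctionLowerBoundOffZeros`).
  [cite: MontgomeryVaughan2007, Lemma 12.6]
-/

noncomputable section

open Complex Real Set Metric MeasureTheory
open Literature.NumberTheory.LFunctions.Zhang2022.Skeleton

namespace Literature.NumberTheory.LFunctions.Zhang2022.Typed.Section15A

open Literature.NumberTheory.LFunctions.Zhang2022

/-! ## Holomorphy of `𝔨₁(s,ψ)ω(s)` on the rectangle -/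

section Holomorphy

variable (c' : ℝ) {D : ℕ} [NeZero D] {χ : DirichletCharacter ℂ D} (x : Chr D)

/-- **The integrand `𝔨₁(s,ψ)ω(s)` of `I₂⁺` is holomorphic on the closed rectangle
`[½+α, 3/2] × [2πt₀−𝓛₁, 2πt₀+𝓛₁]`** for `ψ ∈ Ψ₁` with the zeros of `L(s,ψ)L(s,ψχ)` in `Ω` on the
line (the body of Proposition 2.2 (i) at `ψ`), `D ≥ 3`, `χ` primitive, `0 < α ≤ 1`, `𝓛₁ < 2πt₀`:
`Z(s,χψ)⁻¹` is holomorphic on `Im s > 0`, `L(·,ψ)`, `B`, `K`, `ω` are entire, and `L(s,ψ) ≠ 0` on the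
rectangle (`Step8u016.LFunction_ne_zero_of_onLine`). [cite: Zhang2022LandauSiegel, §15 (15.5) p. 81] -/
theorem differentiableOn_frakk1_omega (hD : 3 ≤ D) (hp : χ.IsPrimitive)
    (h22 : ∀ s ∈ prodZeroSetOmega χ x, s.re = 1 / 2)
    (hα0 : 0 < alpha D) (hα1 : alpha D ≤ 1) (hwin : ell1 D < 2 * π * t0 D) :
    DifferentiableOn ℂ (fun s => frakk1 c' χ x s * omegaW D s)
      (Set.uIcc (1 / 2 + alpha D) (1 / 2 + 1) ×ℂ
        Set.uIcc (2 * π * t0 D - ell1 D) (2 * π * t0 D + ell1 D)) := by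
  intro s hs
  have hre : 1 / 2 + alpha D ≤ s.re ∧ s.re ≤ 1 / 2 + 1 := by
    have h := hs.1
    rw [Set.uIcc_of_le (by linarith)] at h
    exact h
  have hℓ1 : 0 ≤ ell1 D := pow_nonneg (Real.log_natCast_nonneg D) _
  have him : 2 * π * t0 D - ell1 D ≤ s.im ∧ s.im ≤ 2 * π * t0 D + ell1 D := by
    have h := hs.2
    rw [Set.uIcc_of_le (by linarith)] at h
    exact h
  have him0 : 0 < s.im := by linarith
  have himw : |s.im - 2 * π * t0 D| < ell1 D + 2 := by
    rw [abs_lt]; constructor <;> linarith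
  have hL : x.ψ.LFunction s ≠ 0 := Step8u016.LFunction_ne_zero_of_onLine h22 (by linarith) himw
  have hprim := psiChiPrimitive_holds D χ x hD hp
  have hLd := DirichletCharacter.differentiable_LFunction x.ψ_ne_one
  have hZ : DifferentiableAt ℂ (fun s => (Zpc χ x s)⁻¹) s := by
    unfold Zpc
    exact (GammaFactor.differentiableAt_Zfac (psiChi χ x) him0).inv
      (GammaFactor.Zfac_ne_zero hprim him0)
  have hL1 : DifferentiableAt ℂ (fun s => x.ψ.LFunction (s + beta1 c' D)) s :=
    (hLd.comp (differentiable_id.add_const _)).differentiableAt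
  have hL2 : DifferentiableAt ℂ (fun s => x.ψ.LFunction (s + beta2 c' D)) s :=
    (hLd.comp (differentiable_id.add_const _)).differentiableAt
  have hL0 : DifferentiableAt ℂ (fun s => x.ψ.LFunction s) s := hLd.differentiableAt
  have hB : DifferentiableAt ℂ (Bpoly χ x) s :=
    (Typed.Section17.differentiable_Bpoly χ x).differentiableAt
  have hK : DifferentiableAt ℂ (fun s => Kchar D (psiBarFn x) (1 - s - beta3 c' D)) s :=
    ((Step16u010.differentiable_Kchar (psiBarFn x)).comp
      (((differentiable_const (1 : ℂ)).sub differentiable_id).sub_const _)).differentiableAt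
  have hω : DifferentiableAt ℂ (omegaW D) s := (Section7aStatements.differentiable_omegaW D) s
  have hfun : (fun s => frakk1 c' χ x s * omegaW D s) = fun s =>
      (Zpc χ x s)⁻¹ *
        (x.ψ.LFunction (s + beta1 c' D) * x.ψ.LFunction (s + beta2 c' D) / x.ψ.LFunction s) *
        Bpoly χ x s * Kchar D (psiBarFn x) (1 - s - beta3 c' D) * omegaW D s := by
    funext s; rfl
  rw [hfun]
  exact ((((hZ.mul ((hL1.mul hL2).div hL0 hL)).mul hB).mul hK).mul hω).differentiableWithinAt

end Holomorphy

/-! ## The size of `𝔨₁(s,ψ)ω(s)` on the horizontal sides -/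

section EdgeBound

variable (c' : ℝ) {D : ℕ} [NeZero D] {χ : DirichletCharacter ℂ D} (x : Chr D)

/-- **The integrand on the horizontal sides.** For `ψ ∈ Ψ₁` with the zeros of `L(s,ψ)L(s,ψχ)` in `Ω`
on the line, `D ≥ 3`, `χ` primitive, `0 < α ≤ 1/6`, `|c′|α𝓛 ≤ 1`, `𝓛 ≥ 3`, and `s = u + it` with
`½+α ≤ u ≤ 3/2`, `|t − 2πt₀| ≤ 𝓛₁`, `t ≥ 1`:
`|𝔨₁(s,ψ)ω(s)| ≤ [e³Dpt₀]·[p(|t|+5)Z]²·exp(C(1+log(1/α))(log p + log(|t|+4)))·[K_B(P+1)²]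
 ·(2P₄+1)²·(√π/𝓛₂)exp(((u−½)² − (t−2πt₀)²)/(4𝓛₂²))`, `K_B = (1+|ι₂|)(|ι₃|+|ι₄|)`, `C` the absolute
constant of `DirichletDisc.exp_neg_le_norm_LFunction`. [cite: Zhang2022LandauSiegel, §15 (15.5) p. 81] -/
theorem norm_frakk1_omega_le {C : ℝ}
    (hC : ∀ (q : ℕ) [NeZero q] (θ : DirichletCharacter ℂ q), θ ≠ 1 → ∀ t σ d : ℝ,
      1 / 2 ≤ σ → σ ≤ 2 → 0 < d → d ≤ 1 →
        (∀ ρ ∈ DirichletDisc.discZeros θ t, ∀ y ∈ Icc σ 2, d ≤ ‖(y : ℂ) + t * I - ρ‖) →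
          Real.exp (-(C * (1 + Real.log (1 / d)) * (Real.log q + Real.log (|t| + 4)))) ≤
            ‖θ.LFunction ((σ : ℂ) + t * I)‖)
    (h22 : ∀ s ∈ prodZeroSetOmega χ x, s.re = 1 / 2) (hD : 3 ≤ D) (hp : χ.IsPrimitive)
    (hℓ3 : 3 ≤ ell D) (hα0 : 0 < alpha D) (hα : alpha D ≤ 1 / 6)
    (hc : |c'| * (alpha D * ell D) ≤ 1)
    {u t : ℝ} (hu1 : 1 / 2 + alpha D ≤ u) (hu2 : u ≤ 3 / 2) (ht : |t - 2 * π * t0 D| ≤ ell1 D)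
    (ht1 : 1 ≤ t) :
    ‖frakk1 c' χ x ((u : ℂ) + t * I) * omegaW D ((u : ℂ) + t * I)‖ ≤
      (Real.exp 3 * ((D : ℝ) * x.p * t0 D)) * ((x.p : ℝ) * (|t| + 5) * DirichletDisc.Zc) ^ 2 *
        Real.exp (C * (1 + Real.log (1 / alpha D)) * (Real.log x.p + Real.log (|t| + 4))) *
        ((1 + ‖iota2‖) * (‖iota3‖ + ‖iota4‖) * (bigP D + 1) ^ 2) *
        (2 * P4 D + 1) ^ 2 *
        (Real.sqrt π / ell2 D * Real.exp (((u - 1 / 2) ^ 2 - (t - 2 * π * t0 D) ^ 2) /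
          (4 * ell2 D ^ 2))) := by
  set s : ℂ := (u : ℂ) + t * I with hs
  have hsre : s.re = u := by simp [hs]
  have hsim : s.im = t := by simp [hs]
  have ht0 : 0 < t := by linarith
  have hp0 : (0 : ℝ) < x.p := by exact_mod_cast x.prime.pos
  have hℓ : 1 ≤ ell D := (one_lt_ell hD).le
  have hℓ0 : 0 < ell D := by linarith
  have hℓ2 : 2 ≤ Real.log D := by rw [← ell]; linarith
  have ht0D : 0 < t0 D := pow_pos hℓ0 _
  have hZc : 1 ≤ DirichletDisc.Zc := DirichletDisc.one_le_Zc
  obtain ⟨hb1, hb2, -⟩ := Step8u016.abs_b_le_one c' hα0.le hα hc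
  obtain ⟨e1, e2, -⟩ := Section8aStatements.beta_eq_b_mul_I c' D
  -- the factors of `𝔨₁`
  have hF1 : ‖(Zpc χ x s)⁻¹‖ ≤ Real.exp 3 * ((D : ℝ) * x.p * t0 D) :=
    Step16u010.norm_Zpc_inv_le x hD hp (by rw [hsre]; linarith) (by rw [hsre]; linarith)
      (by rw [hsim]; exact ht)
  have hreI : s.re ∈ Icc (1 / 2 : ℝ) 2 := by rw [hsre]; constructor <;> linarith
  have hL1 : ‖x.ψ.LFunction (s + beta1 c' D)‖ ≤ x.p * (|t| + 5) * DirichletDisc.Zc := by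
    rw [e1, ← hsim]; exact Step8u016.norm_LFunction_shift_le x hreI hb1
  have hL2 : ‖x.ψ.LFunction (s + beta2 c' D)‖ ≤ x.p * (|t| + 5) * DirichletDisc.Zc := by
    rw [e2, ← hsim]; exact Step8u016.norm_LFunction_shift_le x hreI hb2
  -- the lower bound for `L(s,ψ)`
  have hα1 : alpha D ≤ 1 := by linarith
  have hdist := DirichletDisc.dist_segment_of_re_le (χ := x.ψ) (t := t) (σ := u) (d := alpha D)
    (fun ρ hρ => by rw [Step8u016.discZeros_re_eq_half h22 ht ρ hρ]; linarith)
  have hLlow := hC x.p x.ψ x.ψ_ne_one t u (alpha D) (by linarith) (by linarith) hα0 hα1 hdist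
  set E : ℝ := Real.exp (C * (1 + Real.log (1 / alpha D)) * (Real.log x.p + Real.log (|t| + 4)))
    with hE
  have hE0 : 0 < E := Real.exp_pos _
  have hLs0 : 0 < ‖x.ψ.LFunction s‖ := lt_of_lt_of_le (Real.exp_pos _) hLlow
  have hF4 : ‖(x.ψ.LFunction s)⁻¹‖ ≤ E := by
    rw [norm_inv, inv_le_comm₀ hLs0 hE0, hE, ← Real.exp_neg]
    exact hLlow
  -- the Dirichlet polynomials
  set KB : ℝ := (1 + ‖iota2‖) * (‖iota3‖ + ‖iota4‖) with hKB
  have hKB0 : 0 ≤ KB := by rw [hKB]; positivity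
  have hP0 : 0 < bigP D := Real.exp_pos _
  have hBp : ‖Bpoly χ x s‖ ≤ KB * (bigP D + 1) ^ 2 :=
    Typed.Section17.norm_Bpoly_le_trivial χ x hℓ2 (by rw [hsre]; linarith)
  have hKp : ‖Kchar D (psiBarFn x) (1 - s - beta3 c' D)‖ ≤ (2 * P4 D + 1) ^ 2 :=
    Step16u010.norm_Kchar_le hℓ0
      (fun n => by rw [psiBarFn, Complex.norm_conj]; exact x.ψ.norm_le_one _)
      (by
        rw [Complex.sub_re, Complex.sub_re, hsre, Complex.one_re,
          show (beta3 c' D).re = 0 by simp [beta3]]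
        linarith)
  -- the weight
  have hℓ20 : 0 < ell2 D := pow_pos hℓ0 _
  have hω : ‖omegaW D s‖ = Real.sqrt π / ell2 D *
      Real.exp (((u - 1 / 2) ^ 2 - (t - 2 * π * t0 D) ^ 2) / (4 * ell2 D ^ 2)) := by
    have hs' : s = ((u - 1 / 2 : ℝ) : ℂ) + SmoothWeight.s0 (t0 D) + ((t - 2 * π * t0 D : ℝ) : ℂ) * I := by
      rw [hs, SmoothWeight.s0_def]; push_cast; ring
    rw [omegaW, hs', SmoothWeight.norm_omega_segment_eq hℓ20]
  -- assembly
  have hfun : frakk1 c' χ x s * omegaW D s = (Zpc χ x s)⁻¹ *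
      (x.ψ.LFunction (s + beta1 c' D) * x.ψ.LFunction (s + beta2 c' D) * (x.ψ.LFunction s)⁻¹) *
      Bpoly χ x s * Kchar D (psiBarFn x) (1 - s - beta3 c' D) * omegaW D s := by
    rw [frakk1, div_eq_mul_inv]
  rw [hfun, norm_mul, norm_mul, norm_mul, norm_mul, norm_mul, norm_mul, hω]
  have ht5 : 0 ≤ |t| + 5 := by linarith [abs_nonneg t]
  have hPZ : 0 ≤ (x.p : ℝ) * (|t| + 5) * DirichletDisc.Zc :=
    mul_nonneg (mul_nonneg hp0.le ht5) (le_trans zero_le_one hZc)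
  have hD0 : (0 : ℝ) ≤ D := Nat.cast_nonneg _
  have hZb : 0 ≤ Real.exp 3 * ((D : ℝ) * x.p * t0 D) :=
    mul_nonneg (Real.exp_pos 3).le (mul_nonneg (mul_nonneg hD0 hp0.le) ht0D.le)
  have hω0 : 0 ≤ Real.sqrt π / ell2 D *
      Real.exp (((u - 1 / 2) ^ 2 - (t - 2 * π * t0 D) ^ 2) / (4 * ell2 D ^ 2)) :=
    mul_nonneg (div_nonneg (Real.sqrt_nonneg _) hℓ20.le) (Real.exp_pos _).le
  have hL12 : ‖x.ψ.LFunction (s + beta1 c' D)‖ * ‖x.ψ.LFunction (s + beta2 c' D)‖ ≤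
      ((x.p : ℝ) * (|t| + 5) * DirichletDisc.Zc) ^ 2 := by
    rw [pow_two]
    exact mul_le_mul hL1 hL2 (norm_nonneg _) hPZ
  have hPZ2 : 0 ≤ ((x.p : ℝ) * (|t| + 5) * DirichletDisc.Zc) ^ 2 := sq_nonneg _
  have hLL : ‖x.ψ.LFunction (s + beta1 c' D)‖ * ‖x.ψ.LFunction (s + beta2 c' D)‖ *
      ‖(x.ψ.LFunction s)⁻¹‖ ≤ ((x.p : ℝ) * (|t| + 5) * DirichletDisc.Zc) ^ 2 * E :=
    mul_le_mul hL12 hF4 (norm_nonneg _) hPZ2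
  have h1 : ‖(Zpc χ x s)⁻¹‖ *
      (‖x.ψ.LFunction (s + beta1 c' D)‖ * ‖x.ψ.LFunction (s + beta2 c' D)‖ *
        ‖(x.ψ.LFunction s)⁻¹‖) ≤
      Real.exp 3 * ((D : ℝ) * x.p * t0 D) * (((x.p : ℝ) * (|t| + 5) * DirichletDisc.Zc) ^ 2 * E) :=
    mul_le_mul hF1 hLL (mul_nonneg (mul_nonneg (norm_nonneg _) (norm_nonneg _)) (norm_nonneg _)) hZb
  have n1 : 0 ≤ Real.exp 3 * ((D : ℝ) * x.p * t0 D) *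
      (((x.p : ℝ) * (|t| + 5) * DirichletDisc.Zc) ^ 2 * E) := mul_nonneg hZb (mul_nonneg hPZ2 hE0.le)
  have h2 := mul_le_mul h1 hBp (norm_nonneg _) n1
  have h3 := mul_le_mul h2 hKp (norm_nonneg _) (mul_nonneg n1 (mul_nonneg hKB0 (sq_nonneg _)))
  have h4 := mul_le_mul_of_nonneg_right h3 hω0
  refine h4.trans (le_of_eq ?_)
  rw [hE, hKB]; ring

/-- **The integrand on either horizontal side, uniformly in `ψ` and `u`**: with the hypotheses of
`norm_frakk1_omega_le`, `𝓛 ≥ 3` and `π|c′| ≤ 𝓛⁸`, on `s = u + i(2πt₀ ± 𝓛₁)`, `½+α ≤ u ≤ 3/2`,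
`|𝔨₁(s,ψ)ω(s)| ≤ K·P¹³·exp(3C𝓛⁹(1+9log𝓛))·e^{−𝓛¹⁰/4}`, `K = e³·3·(39Z)²·K_B·36·6`.
[cite: Zhang2022LandauSiegel, §15 (15.5) p. 81] -/
theorem norm_frakk1_omega_le_uniform {C : ℝ} (hC0 : 0 < C)
    (hC : ∀ (q : ℕ) [NeZero q] (θ : DirichletCharacter ℂ q), θ ≠ 1 → ∀ t σ d : ℝ,
      1 / 2 ≤ σ → σ ≤ 2 → 0 < d → d ≤ 1 →
        (∀ ρ ∈ DirichletDisc.discZeros θ t, ∀ y ∈ Icc σ 2, d ≤ ‖(y : ℂ) + t * I - ρ‖) →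
          Real.exp (-(C * (1 + Real.log (1 / d)) * (Real.log q + Real.log (|t| + 4)))) ≤
            ‖θ.LFunction ((σ : ℂ) + t * I)‖)
    (x : Chr D) (h22 : ∀ s ∈ prodZeroSetOmega χ x, s.re = 1 / 2) (hD : 3 ≤ D)
    (hp : χ.IsPrimitive) (hℓ : 3 ≤ ell D) (hc : π * |c'| ≤ ell D ^ 8)
    {u : ℝ} (hu1 : 1 / 2 + alpha D ≤ u) (hu2 : u ≤ 1 / 2 + 1) {t : ℝ}
    (ht : t = 2 * π * t0 D + ell1 D ∨ t = 2 * π * t0 D - ell1 D) :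
    ‖frakk1 c' χ x ((u : ℂ) + t * I) * omegaW D ((u : ℂ) + t * I)‖ ≤
      (Real.exp 3 * 3 * (39 * DirichletDisc.Zc) ^ 2 * ((1 + ‖iota2‖) * (‖iota3‖ + ‖iota4‖)) *
          36 * 6) * bigP D ^ 13 *
        Real.exp (3 * C * ell D ^ 9 * (1 + 9 * Real.log (ell D))) *
        Real.exp (-(ell D ^ 10) / 4) := by
  obtain ⟨hα0, hα6, hα1⟩ := Step8u016.alpha_small hℓ
  obtain ⟨hwin, hℓ1t0, ht01, hℓ21, hℓ10⟩ := Step8u016.window_sizes hℓ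
  have hcα := Step8u016.abs_c_mul_alpha_ell_le_one (c' := c') hℓ hc
  have hπ3 := Real.pi_gt_three
  have hπ4 := Real.pi_lt_four
  have htabs : |t - 2 * π * t0 D| ≤ ell1 D := by
    rcases ht with ht' | ht'
    · rw [ht', show 2 * π * t0 D + ell1 D - 2 * π * t0 D = ell1 D by ring, abs_of_nonneg hℓ10]
    · rw [ht', show 2 * π * t0 D - ell1 D - 2 * π * t0 D = -ell1 D by ring, abs_neg,
        abs_of_nonneg hℓ10]
  have hπt : π * t0 D ≤ 7 / 2 * t0 D :=
    mul_le_mul_of_nonneg_right (by linarith [Real.pi_lt_d2]) (by linarith)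
  have hπt' : 3 * t0 D ≤ π * t0 D := mul_le_mul_of_nonneg_right hπ3.le (by linarith)
  have ht1 : 1 ≤ t := by rcases ht with ht' | ht' <;> rw [ht'] <;> linarith
  have htle : |t| ≤ 8 * t0 D := by
    rw [abs_of_pos (by linarith)]
    rcases ht with ht' | ht' <;> rw [ht'] <;> linarith
  -- sizes
  have hP0 : 0 < bigP D := Real.exp_pos _
  have hP1 : 1 ≤ bigP D := Real.one_le_exp (pow_nonneg (Real.log_natCast_nonneg D) 9)
  have hp3 := Step8u016.chr_p_le_three_bigP hℓ x
  have hp1 : (1 : ℝ) ≤ x.p := by exact_mod_cast x.prime.one_lt.le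
  have ht0P := Step8u016.t0_le_bigP hℓ
  have hDP := Step16u010.natCast_le_bigP hD
  have hD0 : (0 : ℝ) ≤ D := Nat.cast_nonneg _
  have hP4 := Step16u010.P4_le_bigP_sq hℓ
  have hP40 : 0 ≤ P4 D := Typed.Section16ALeaves.P4_nonneg D
  have hZ1 : 1 ≤ DirichletDisc.Zc := DirichletDisc.one_le_Zc
  set KB : ℝ := (1 + ‖iota2‖) * (‖iota3‖ + ‖iota4‖) with hKB
  have hKB0 : 0 ≤ KB := by rw [hKB]; positivity
  have ht4 : |t| + 4 ≤ 12 * bigP D := by nlinarith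
  -- factor 1: `e³ D p t₀ ≤ e³·P·3P·P`
  have f1 : Real.exp 3 * ((D : ℝ) * x.p * t0 D) ≤ Real.exp 3 * (bigP D * (3 * bigP D) * bigP D) := by
    apply mul_le_mul_of_nonneg_left _ (Real.exp_pos 3).le
    exact mul_le_mul (mul_le_mul hDP hp3 (by positivity) hP0.le) ht0P (by positivity) (by positivity)
  -- factor 2: `(p(|t|+5)Z)² ≤ (3P·13P·Z)²`
  have f2 : ((x.p : ℝ) * (|t| + 5) * DirichletDisc.Zc) ^ 2 ≤
      (3 * bigP D * (13 * bigP D) * DirichletDisc.Zc) ^ 2 := by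
    apply pow_le_pow_left₀ (by positivity)
    apply mul_le_mul_of_nonneg_right _ (by linarith)
    exact mul_le_mul hp3 (by nlinarith) (by positivity) (by linarith)
  -- factor 3: the exponent
  have f3 : Real.exp (C * (1 + Real.log (1 / alpha D)) * (Real.log x.p + Real.log (|t| + 4))) ≤
      Real.exp (3 * C * ell D ^ 9 * (1 + 9 * Real.log (ell D))) := by
    rw [Real.exp_le_exp, mul_assoc]
    have h := Step8u016.log_factor_le hℓ hp1 hp3 ht4
    calc C * ((1 + Real.log (1 / alpha D)) * (Real.log x.p + Real.log (|t| + 4)))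
        ≤ C * ((1 + 9 * Real.log (ell D)) * (3 * ell D ^ 9)) := mul_le_mul_of_nonneg_left h hC0.le
      _ = 3 * C * ell D ^ 9 * (1 + 9 * Real.log (ell D)) := by ring
  -- factor 4: `K_B(P+1)² ≤ K_B(2P)²`
  have f4 : KB * (bigP D + 1) ^ 2 ≤ KB * (2 * bigP D) ^ 2 := by
    apply mul_le_mul_of_nonneg_left _ hKB0
    apply pow_le_pow_left₀ (by positivity); linarith
  -- factor 6: `(2P₄+1)² ≤ (3P²)²`
  have f6 : (2 * P4 D + 1) ^ 2 ≤ (3 * bigP D ^ 2) ^ 2 := by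
    apply pow_le_pow_left₀ (by positivity)
    nlinarith [one_le_pow₀ (M₀ := ℝ) hP1 (n := 2)]
  -- factor 7: the Gaussian
  have f7 : Real.sqrt π / ell2 D * Real.exp (((u - 1 / 2) ^ 2 - (t - 2 * π * t0 D) ^ 2) /
      (4 * ell2 D ^ 2)) ≤ 6 * Real.exp (-(ell D ^ 10) / 4) := by
    have hsq : (t - 2 * π * t0 D) ^ 2 = ell1 D ^ 2 := by
      rcases ht with ht' | ht' <;> rw [ht'] <;> ring
    rw [hsq]
    exact Step8u016.omega_edge_le hℓ (pow_le_one₀ (by linarith) (by linarith))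
  -- combine
  have hbase := norm_frakk1_omega_le c' x hC h22 hD hp hℓ hα0 hα6 hcα hu1 (by linarith) htabs ht1
  refine hbase.trans ?_
  have h0f2 : 0 ≤ ((x.p : ℝ) * (|t| + 5) * DirichletDisc.Zc) ^ 2 := by positivity
  have h0f3 : 0 ≤ Real.exp (C * (1 + Real.log (1 / alpha D)) * (Real.log x.p + Real.log (|t| + 4))) :=
    (Real.exp_pos _).le
  have h0f4 : 0 ≤ KB * (bigP D + 1) ^ 2 := by positivity
  have h0f6 : 0 ≤ (2 * P4 D + 1) ^ 2 := by positivity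
  have h0ω : 0 ≤ Real.sqrt π / ell2 D *
      Real.exp (((u - 1 / 2) ^ 2 - (t - 2 * π * t0 D) ^ 2) / (4 * ell2 D ^ 2)) :=
    mul_nonneg (div_nonneg (Real.sqrt_nonneg _) (by linarith)) (Real.exp_pos _).le
  calc Real.exp 3 * ((D : ℝ) * x.p * t0 D) * ((x.p : ℝ) * (|t| + 5) * DirichletDisc.Zc) ^ 2 *
        Real.exp (C * (1 + Real.log (1 / alpha D)) * (Real.log x.p + Real.log (|t| + 4))) *
        (KB * (bigP D + 1) ^ 2) * (2 * P4 D + 1) ^ 2 *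
        (Real.sqrt π / ell2 D *
          Real.exp (((u - 1 / 2) ^ 2 - (t - 2 * π * t0 D) ^ 2) / (4 * ell2 D ^ 2)))
      ≤ Real.exp 3 * (bigP D * (3 * bigP D) * bigP D) *
        (3 * bigP D * (13 * bigP D) * DirichletDisc.Zc) ^ 2 *
        Real.exp (3 * C * ell D ^ 9 * (1 + 9 * Real.log (ell D))) *
        (KB * (2 * bigP D) ^ 2) * (3 * bigP D ^ 2) ^ 2 *
        (6 * Real.exp (-(ell D ^ 10) / 4)) := by
        have g1 := mul_le_mul f1 f2 h0f2 (by positivity)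
        have g2 := mul_le_mul g1 f3 h0f3 (by positivity)
        have g3 := mul_le_mul g2 f4 h0f4 (by positivity)
        have g5 := mul_le_mul g3 f6 h0f6 (by positivity)
        exact mul_le_mul g5 f7 h0ω (by positivity)
    _ = (Real.exp 3 * 3 * (39 * DirichletDisc.Zc) ^ 2 * KB * 36 * 6) * bigP D ^ 13 *
        Real.exp (3 * C * ell D ^ 9 * (1 + 9 * Real.log (ell D))) *
        Real.exp (-(ell D ^ 10) / 4) := by ring

end EdgeBound

/-! ## The move `𝔍(α) → 𝔍(1)` per character, and (15.5) -/

section Assembly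

variable (c' : ℝ)

/-- **The segment move for `I₂⁺(ψ)`, per character, as an edge from Proposition 2.2 (i)**: if for
`ψ ∈ Ψ₁` the zeros of `L(s,ψ)L(s,ψχ)` in `Ω` lie on the critical line (`Skeleton.Prop22i`), then for every
`c′`, for all large `D` and every `ψ ∈ Ψ₁`:
`‖(1/2πi)∫_{𝔍(α)} 𝔨₁(s,ψ)ω(s)ds − (1/2πi)∫_{𝔍(1)} 𝔨₁(s,ψ)ω(s)ds‖ ≤ 1·exp(−𝓛¹⁰/16)`. Cauchy's theorem
on `[½+α, 3/2]×[2πt₀−𝓛₁, 2πt₀+𝓛₁]` (`Section7aStatements.norm_intJ_sub_intJ_le`, holomorphy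
`differentiableOn_frakk1_omega`) leaves the two horizontal sides, each `≤ K·P¹³e^{3C𝓛⁹(1+9log𝓛)}e^{−𝓛¹⁰/4}`
pointwise (`norm_frakk1_omega_le_uniform`), and `K·P¹³e^{3C𝓛⁹(1+9log𝓛)} ≤ e^{3𝓛¹⁰/16}` for large `𝓛`
(`Step8u016.growth_le` at `C + 1/3`). [cite: Zhang2022LandauSiegel, §15 (15.5) p. 81] -/
theorem norm_I2pm_shift_le_of (h22 : Prop22i) :
    ∃ c : ℝ, 0 < c ∧ ∃ C : ℝ, ForAllLarge fun D _ χ => ∀ x ∈ PsiOne χ,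
      ‖I2pm c' χ x (alpha D) - I2pm c' χ x 1‖ ≤ C * Real.exp (-c * ell D ^ 10) := by
  classical
  obtain ⟨C, hC0, hC⟩ := DirichletDisc.exp_neg_le_norm_LFunction
  obtain ⟨D₁, h22'⟩ := h22
  -- the constant and the growth threshold on `𝓛`
  set KB : ℝ := (1 + ‖iota2‖) * (‖iota3‖ + ‖iota4‖) with hKB
  have hKB0 : 0 ≤ KB := by rw [hKB]; positivity
  set K : ℝ := Real.exp 3 * 3 * (39 * DirichletDisc.Zc) ^ 2 * KB * 36 * 6 with hK
  have hK0 : 0 ≤ K := by rw [hK]; have := DirichletDisc.one_le_Zc; positivity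
  set C' : ℝ := C + 1 / 3 with hC'
  have hC'0 : 0 ≤ C' := by rw [hC']; linarith
  obtain ⟨D₃, hD₃f⟩ := Skeleton.exists_forall_le_ell
    (max 3 (max (π * |c'| + 1) (max (64 * K + 1) ((8 * (14 + 57 * C')) ^ 2))))
  refine ⟨1 / 16, by norm_num, 1, max D₁ (max D₃ 3), fun D _ χ hD hq hp y hy => ?_⟩
  have hD₁ : D₁ ≤ D := le_trans (le_max_left _ _) hD
  have hD₃ : D₃ ≤ D := le_trans (le_trans (le_max_left _ _) (le_max_right _ _)) hD
  have hD3 : 3 ≤ D := le_trans (le_trans (le_max_right _ _) (le_max_right _ _)) hD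
  have hM := hD₃f D hD₃
  have hℓ3 : 3 ≤ ell D := le_trans (le_max_left _ _) hM
  have hℓc : π * |c'| + 1 ≤ ell D := le_trans (le_trans (le_max_left _ _) (le_max_right _ _)) hM
  have hℓK : 64 * K + 1 ≤ ell D :=
    le_trans (le_trans (le_trans (le_max_left _ _) (le_max_right _ _)) (le_max_right _ _)) hM
  have hℓA : (8 * (14 + 57 * C')) ^ 2 ≤ ell D :=
    le_trans (le_trans (le_trans (le_max_right _ _) (le_max_right _ _)) (le_max_right _ _)) hM
  have hℓ1 : 1 ≤ ell D := by linarith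
  have hℓ0 : 0 < ell D := by linarith
  have h22y : ∀ s ∈ prodZeroSetOmega χ y, s.re = 1 / 2 := h22' D χ hD₁ hq hp y hy
  obtain ⟨hα0, hα6, hα1⟩ := Step8u016.alpha_small hℓ3
  obtain ⟨hwin, -, ht01, -, hℓ10⟩ := Step8u016.window_sizes hℓ3
  have hc8 : π * |c'| ≤ ell D ^ 8 := by
    have : ell D ≤ ell D ^ 8 := by
      calc ell D = ell D ^ 1 := (pow_one _).symm
        _ ≤ ell D ^ 8 := pow_le_pow_right₀ hℓ1 (by norm_num)
    linarith
  -- the uniform side bound `Mval`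
  set Mval : ℝ := K * bigP D ^ 13 * Real.exp (3 * C * ell D ^ 9 * (1 + 9 * Real.log (ell D))) *
    Real.exp (-(ell D ^ 10) / 4) with hMval
  have hP0 : 0 < bigP D := Real.exp_pos _
  have hMval0 : 0 ≤ Mval := by
    rw [hMval]
    exact mul_nonneg (mul_nonneg (mul_nonneg hK0 (pow_nonneg hP0.le 13)) (Real.exp_pos _).le)
      (Real.exp_pos _).le
  -- Cauchy's theorem on the rectangle
  have hF := differentiableOn_frakk1_omega c' y hD3 hp h22y hα0 hα1 hwin
  have hside : ∀ t : ℝ, (t = 2 * π * t0 D + ell1 D ∨ t = 2 * π * t0 D - ell1 D) →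
      ∀ u ∈ Set.Icc (1 / 2 + alpha D) (1 / 2 + 1),
        ‖frakk1 c' χ y ((u : ℂ) + ((t : ℝ) : ℂ) * I) * omegaW D ((u : ℂ) + ((t : ℝ) : ℂ) * I)‖ ≤
          Mval := by
    intro t ht u hu
    have h := norm_frakk1_omega_le_uniform c' hC0 hC y h22y hD3 hp hℓ3 hc8 hu.1 hu.2 ht
    rw [hMval, hK, hKB]; exact h
  have hmove := Section7aStatements.norm_intJ_sub_intJ_le D (z₁ := alpha D) (z₂ := 1)
    (M₁ := Mval) (M₂ := Mval) hα1 hF (hside _ (Or.inl rfl)) (hside _ (Or.inr rfl))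
  -- `I₂(α) − I₂(1) = (intJ α − intJ 1)/(2πi)`
  have hI : I2pm c' χ y (alpha D) - I2pm c' χ y 1 =
      (Section7aStatements.intJ D (alpha D) (fun s => frakk1 c' χ y s * omegaW D s) -
        Section7aStatements.intJ D 1 (fun s => frakk1 c' χ y s * omegaW D s)) / (2 * π * I) := by
    rw [I2pm, I2pm, Step8u016.segInt_eq_intJ_div, Step8u016.segInt_eq_intJ_div, sub_div]
  have hnorm2 : ‖(2 : ℂ) * π * I‖ = 2 * π := by
    rw [norm_mul, norm_mul, Complex.norm_I, mul_one, Complex.norm_real, Real.norm_eq_abs,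
      abs_of_pos Real.pi_pos]
    norm_num
  have hper : ‖I2pm c' χ y (alpha D) - I2pm c' χ y 1‖ ≤ Mval := by
    rw [hI, norm_div, hnorm2, ← norm_neg, neg_sub, div_le_iff₀ (by positivity)]
    calc ‖Section7aStatements.intJ D 1 (fun s => frakk1 c' χ y s * omegaW D s) -
          Section7aStatements.intJ D (alpha D) (fun s => frakk1 c' χ y s * omegaW D s)‖
        ≤ (1 - alpha D) * (Mval + Mval) := hmove
      _ ≤ 1 * (Mval + Mval) := by gcongr; linarith
      _ ≤ Mval * (2 * π) := by nlinarith [Real.pi_gt_three]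
  refine hper.trans ?_
  -- the final size estimate: `Mval ≤ e^{−𝓛¹⁰/16}`
  have hP : bigP D = Real.exp (ell D ^ 9) := rfl
  have hgrowth := Step8u016.growth_le hC'0 hℓ1 (by
    calc 8 * (14 + 57 * C') = Real.sqrt ((8 * (14 + 57 * C')) ^ 2) := by
          rw [Real.sqrt_sq (by positivity)]
      _ ≤ Real.sqrt (ell D) := Real.sqrt_le_sqrt hℓA)
  -- `K ≤ e^{𝓛¹⁰/16}`
  have hconst : K ≤ Real.exp (ell D ^ 10 / 16) := by
    have h2 : ell D ≤ ell D ^ 10 := by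
      calc ell D = ell D ^ 1 := (pow_one _).symm
        _ ≤ ell D ^ 10 := pow_le_pow_right₀ hℓ1 (by norm_num)
    calc K ≤ ell D ^ 10 / 16 := by linarith
      _ ≤ ell D ^ 10 / 16 + 1 := by linarith
      _ ≤ Real.exp (ell D ^ 10 / 16) := Real.add_one_le_exp _
  -- `P¹³ e^{3C𝓛⁹(1+9log𝓛)} ≤ P¹⁵ e^{3C𝓛⁹(1+9log𝓛)} ≤ e^{𝓛¹⁰/8}`
  have hP15 : bigP D ^ 15 = Real.exp (15 * ell D ^ 9) := by
    rw [hP, ← Real.exp_nat_mul]; norm_num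
  have hP1 : 1 ≤ bigP D := Real.one_le_exp (pow_nonneg (Real.log_natCast_nonneg D) 9)
  have hP13 : bigP D ^ 13 ≤ bigP D ^ 15 := pow_le_pow_right₀ hP1 (by norm_num)
  have hlog0 : 0 ≤ Real.log (ell D) := Real.log_nonneg hℓ1
  have hmid : bigP D ^ 13 * Real.exp (3 * C * ell D ^ 9 * (1 + 9 * Real.log (ell D))) ≤
      Real.exp (ell D ^ 10 / 8) := by
    calc bigP D ^ 13 * Real.exp (3 * C * ell D ^ 9 * (1 + 9 * Real.log (ell D)))
        ≤ bigP D ^ 15 * Real.exp (3 * C * ell D ^ 9 * (1 + 9 * Real.log (ell D))) :=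
          mul_le_mul_of_nonneg_right hP13 (Real.exp_pos _).le
      _ ≤ Real.exp (ell D ^ 10 / 8) := by
          rw [hP15, ← Real.exp_add, Real.exp_le_exp]
          have e9 : 0 ≤ ell D ^ 9 := by positivity
          have : 15 * ell D ^ 9 + 3 * C * ell D ^ 9 * (1 + 9 * Real.log (ell D)) ≤
              (14 + 3 * C') * ell D ^ 9 + 27 * C' * ell D ^ 9 * Real.log (ell D) := by
            rw [hC']
            have h27 : 0 ≤ ell D ^ 9 * Real.log (ell D) := mul_nonneg e9 hlog0
            nlinarith
          exact this.trans hgrowth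
  have e : Mval = K * (bigP D ^ 13 * Real.exp (3 * C * ell D ^ 9 * (1 + 9 * Real.log (ell D)))) *
      Real.exp (-(ell D ^ 10) / 4) := by
    rw [hMval]; ring
  rw [e]
  have h1 := mul_le_mul hconst hmid
    (mul_nonneg (pow_nonneg hP0.le 13) (Real.exp_pos _).le) (Real.exp_pos _).le
  have h2 := mul_le_mul_of_nonneg_right h1 (Real.exp_pos (-(ell D ^ 10) / 4)).le
  refine h2.trans (le_of_eq ?_)
  rw [← Real.exp_add, ← Real.exp_add, one_mul]
  congr 1; ring

/-- **`Z22:(15.5)` (χ-absorbed reading `b = χ·b`) as an edge from Proposition 2.2 (i)**: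
`Σ_{ψ∈Ψ₁} I₂⁺(ψ) = Θ₂(0,𝐤₁*,𝐚₁*) + O(ε)`, `κ₁* = κ₁∗(χb)`, `a₁* = g̃₃` — the per-character move
`norm_I2pm_shift_le_of` fed into the landed edge `eq15_5_chi_of_shift` (sum over `#Ψ₁ ≤ 𝔓 ≤ 2P²`
characters and the exact identity `Σ_{ψ∈Ψ₁} I₂(ψ;𝔍(1)) = Θ₂(0,𝐤₁*,𝐚₁*)`).
[cite: Zhang2022LandauSiegel, §15 (15.5) p. 81] -/
theorem eq15_5_chi_of_prop22i (h22 : Prop22i) : Eq15_5 c' bChi := by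
  obtain ⟨c, hc, C, D₀, h⟩ := norm_I2pm_shift_le_of c' h22
  exact eq15_5_chi_of_shift c' ⟨c, hc, C, D₀, fun D _ χ hD hq hp _ => h D χ hD hq hp⟩

/-- **`Z22:(15.5)` DISCHARGED in the χ-absorbed reading of record** (`Typed.Section15A.Eq15_5 c′ bChi`,
every real `c′`): "moving the segment `𝔍(α)` to `𝔍(1)` with a negligible error, we obtain
`Σ_{ψ∈Ψ₁} I₂⁺(ψ) = Θ₂(0,𝐤₁*,𝐚₁*) + O(ε)`" — unconditional, Proposition 2.2 (i) being the tree theorem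
`Skeleton.prop22i_holds`. [cite: Zhang2022LandauSiegel, §15 (15.5) p. 81] -/
theorem eq15_5_chi_holds : Eq15_5 c' bChi := eq15_5_chi_of_prop22i c' prop22i_holds

end Assembly

end Literature.NumberTheory.LFunctions.Zhang2022.Typed.Section15A
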